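import Summits.ResolutionOfSingularities.ResolutionOfSingularities.Theorems.FrobeniusClosingSteerInsepStepMaximalIdeal
import Summits.ResolutionOfSingularities.ResolutionOfSingularities.Theorems.FrobeniusClosingSteerInsepStepDerivations
import Summits.ResolutionOfSingularities.ResolutionOfSingularities.Theorems.FrobeniusClosingSteerInsepStepReadings
import Summits.ResolutionOfSingularities.ResolutionOfSingularities.Theorems.FrobeniusClosingSteerInsepStepReadingTools
import HarnessLib

/-!
# Steer / LEMMA I kernel, file F5: THE DEGREE-TWO INSEPARABLE NEAR POINT — `F₁ − ψ² ∈ (X, z')²`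

OURS (campaign res-hironaka, rung L ★L-G4, slot W4.1, crux `Steer` stmt-ResolutionOfSingularities-16345; res-L0-w41-plan-1 RULING 155a, kernel of
res-L0-w41-idea-3's LEMMA I `InsepStepNotIsolated`; res-L0-w41-stub-3 g7, blueprint `KERNEL-BLUEPRINT-LemmaI.md` 693d33707585fe97 §4 Case B; replaces the
role of no printed item; NOT a statement of the manuscript under review [claim: Hironaka2017, status: under-review]; AI review is weaker than expert review).
Theses-free, definition-free.

**`exists_sub_sq_mem_sq_of_degTwo`.** Point step `S₀ ≤ S₁` (quadratic transform of regular local subrings of a field of characteristic `2`, `dim S₁ = 3`),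
chart `X`, adapted parameters `𝔪₀ = (X, Y, Z)`, `t = Y/X`, `z' = Z/X` with `z' ∈ 𝔪₁`, `t̄ ∉ κ₀`, `t² − ℓ ∈ 𝔪₁`; an 𝔪₀-adapted dual `2`-basis frame on `S₀`
(res-L0-w41-stub-4's `exists_frame_int` clauses, produced from the geometric chart by `exists_frame_of_chart`); `f ∈ 𝔪₀^d`, `d ≥ 4`, weak transform
`F₁` (`F₁ X^d = f`) of CLEANED ORDER `≥ d` (`F₁ − g₁² ∈ 𝔪₁^d`). THEN `F₁ − ψ² ∈ (X, z')²` for some `ψ ∈ S₁`. Proof = the four readings of the blueprint: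
(R-z') kills the `Z`-linear layer of the form `F` (`F₁ ≡ F(1,t,0) mod (X,z')²`), (R-t) kills the odd powers of `T`, (R-u) + kernel exactness makes the
even coefficients squares mod `𝔪₀`, so `F(1,t,0) = ψ² + X·α`; (R-E) with the Euler extension `E₁` (`E₁ S₁ ⊆ X S₁`, `X ∉ 𝔪₁²`, Zariski–Samuel order
additivity) reads `ᾱ ∈ 𝔫^{d−1}` — the one place `d ≥ 4` is used — and the polynomial lemma (PL₁) puts `α ∈ (X, z')`. Every reading is `LemmaI.polyLemma_one`
in `R̄ = S₁ ⧸ (X, z')`. [cite: Matsumura1987, Thm. 17.10, Thm. 30.6] [cite: ZariskiSamuel1960, Ch. VIII §1 Thm. 1] [folklore]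
-/

noncomputable section

-- single-problem summit: the doubled namespace component `ResolutionOfSingularities` is forced
set_option linter.dupNamespace false

namespace Summit.ResolutionOfSingularities.ResolutionOfSingularities.Theorems.SwitchingDichotomy.LemmaI

open IsLocalRing MvPolynomial Literature.AlgebraicGeometry.Resolution
open Summit.ResolutionOfSingularities.ResolutionOfSingularities.Theorems.SwitchingDichotomy

variable {L : Type} [Field L] {S₀ S₁ : Subring L}

/-! ## The theorem -/

set_option maxHeartbeats 400000 in
/-- **LEMMA I at a degree-two inseparable near point: `F₁ − ψ² ∈ (X, z')²`.** See the module docstring. OURS; replaces the role of no printed item; NOT a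
statement of the manuscript under review. [cite: Matsumura1987, Thm. 17.10, Thm. 30.6] [cite: ZariskiSamuel1960, Ch. VIII §1 Thm. 1] [folklore] -/
theorem exists_sub_sq_mem_sq_of_degTwo [CharP L 2] [IsLocalRing S₀] [IsLocalRing S₁]
    (hreg₀ : IsRegularLocalRing S₀) (hreg₁ : IsRegularLocalRing S₁) (hdim₁ : ringKrullDim S₁ = 3)
    (hQT : IsQuadraticTransform S₀ S₁) (h : S₀ ≤ S₁)
    {X Y Z : S₀} (hXYZ : Ideal.span {X, Y, Z} = maximalIdeal S₀) (hX0 : (X : L) ≠ 0) (hB : blowupRing S₀ (X : L) ≤ S₁)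
    (hfrac : ∀ w ∈ S₁, ∃ a ∈ blowupRing S₀ (X : L), ∃ b ∈ blowupRing S₀ (X : L), b⁻¹ ∈ S₁ ∧ w = a / b)
    (t₁ z₁ : S₁) (ht₁ : (t₁ : L) = Y / X) (hz₁ : (z₁ : L) = Z / X)
    (hz₁m : z₁ ∈ maximalIdeal S₁) (ht : ∀ a : S₀, t₁ - Subring.inclusion h a ∉ maximalIdeal S₁)
    (ℓ : S₀) (hq : t₁ ^ 2 - Subring.inclusion h ℓ ∈ maximalIdeal S₁)
    {e : ℕ} (u : Fin e → S₀) (δ : Fin e → Derivation ℤ (ResidueField S₀) (ResidueField S₀))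
    (dx : Fin 3 → Derivation ℤ S₀ S₀) (du : Fin e → Derivation ℤ S₀ S₀)
    (hgen : Subfield.closure (Set.range (fun y : ResidueField S₀ => y ^ 2) ∪ Set.range (fun j => residue S₀ (u j))) = ⊤)
    (hδu : ∀ j j', δ j (residue S₀ (u j')) = if j' = j then 1 else 0)
    (hδker : ∀ y : ResidueField S₀, (∀ j, δ j y = 0) ↔ ∃ t, t ^ 2 = y)
    (hdx : ∀ i i', dx i (![X, Y, Z] i') = if i' = i then 1 else 0)
    (hdux : ∀ j i, du j (![X, Y, Z] i) = 0) (hduu : ∀ j j', du j (u j') = if j' = j then 1 else 0)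
    {d : ℕ} (hd : 4 ≤ d) {f : S₀} (hf : f ∈ maximalIdeal S₀ ^ d) {F₁ : S₁}
    (hF₁ : F₁ * Subring.inclusion h X ^ d = Subring.inclusion h f) (hord : ∃ g₁ : S₁, F₁ - g₁ ^ 2 ∈ maximalIdeal S₁ ^ d) :
    ∃ ψ : S₁, F₁ - ψ ^ 2 ∈ Ideal.span {Subring.inclusion h X, z₁} ^ 2 := by
  classical
  haveI := hreg₀
  haveI := hreg₁
  set ι := Subring.inclusion h with hι
  have hdom : SubringDominates S₀ S₁ := hQT.dominates
  obtain ⟨n, rfl⟩ : ∃ n, d = n + 1 := ⟨d - 1, by omega⟩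
  have hn3 : 3 ≤ n := by omega
  -- ### elements
  obtain ⟨hXm, hYm, hZm⟩ := mem_of_span_triple_eq hXYZ
  have hx0 : Ideal.span (Set.range ![X, Y, Z]) = maximalIdeal S₀ := by rw [span_range_vec3]; exact hXYZ
  have htX : t₁ * ι X = ι Y := div_mul_exc_eq h hX0 t₁ ht₁
  have hzX : z₁ * ι X = ι Z := div_mul_exc_eq h hX0 z₁ hz₁
  set q : S₁ := t₁ ^ 2 - ι ℓ with hqdef
  set I : Ideal S₁ := Ideal.span {ι X, z₁} with hI
  have hXI : ι X ∈ I := Ideal.subset_span (by simp)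
  have hzI : z₁ ∈ I := Ideal.subset_span (by simp)
  have hspanX_le : Ideal.span {ι X} ≤ I := by rw [Ideal.span_le, Set.singleton_subset_iff]; exact hXI
  have hspanz_le : Ideal.span {z₁} ≤ I := by rw [Ideal.span_le, Set.singleton_subset_iff]; exact hzI
  have hmapm0 : (maximalIdeal S₀).map ι ≤ I := (map_maximalIdeal_le_span_exc h hB hX0).trans hspanX_le
  have hm0I : ∀ a ∈ maximalIdeal S₀, ι a ∈ I := fun a ha => hmapm0 (Ideal.mem_map_of_mem ι ha)
  have hm01 : ∀ a ∈ maximalIdeal S₀, ι a ∈ maximalIdeal S₁ := fun a ha => (inclusion_mem_maximalIdeal_iff hdom a).mpr ha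
  -- ### structure of `𝔪₁` and the quotient `R̄ = S₁ ⧸ I` (F2b)
  have hm1 : maximalIdeal S₁ = Ideal.span {ι X, z₁, q} :=
    maximalIdeal_eq_span_triple hQT hdom hXYZ hX0 hB hfrac t₁ z₁ ht₁ hz₁ hz₁m ht ℓ hq
  have h31 : (maximalIdeal S₁).spanFinrank = 3 := spanFinrank_eq_three hdim₁
  have hx1 : Ideal.span (Set.range ![ι X, z₁, q]) = maximalIdeal S₁ := by rw [span_range_vec3]; exact hm1.symm
  have hX2 : ι X ∉ maximalIdeal S₁ ^ 2 := by simpa using rsop_not_mem_sq h31 ![ι X, z₁, q] hx1 0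
  have hIm : I ≤ maximalIdeal S₁ := by
    rw [hI, Ideal.span_le]
    rintro w hw
    simp only [Set.mem_insert_iff, Set.mem_singleton_iff] at hw
    rcases hw with rfl | rfl
    · exact hm01 X hXm
    · exact hz₁m
  haveI hRreg : IsRegularLocalRing (S₁ ⧸ I) := isRegularLocalRing_quotient_pair h31 (ι X) z₁ q hm1.symm
  haveI : IsDomain (S₁ ⧸ I) := isDomain_of_isRegularLocalRing _
  set mk : S₁ →+* S₁ ⧸ I := Ideal.Quotient.mk I with hmk
  have hmR : maximalIdeal (S₁ ⧸ I) = Ideal.span {mk q} := maximalIdeal_quotient_eq_span (ι X) z₁ q hm1.symm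
  have hq0 : mk q ≠ 0 := mk_ne_zero_of_spanFinrank (ι X) z₁ q hm1.symm h31
  -- ### the polynomial lemma in `R̄`
  have PL : ∀ (N : ℕ) (G : Polynomial S₀), G.degree < (2 * N : ℕ) →
      G.eval₂ (mk.comp ι) (mk t₁) ∈ maximalIdeal (S₁ ⧸ I) ^ N → ∀ j, G.coeff j ∈ maximalIdeal S₀ := by
    refine polyLemma_one (mk.comp ι) (maximalIdeal S₀) (fun m hm => ?_) (mk t₁) ℓ ?_ ?_ ?_
    · exact Ideal.Quotient.eq_zero_iff_mem.mpr (hm0I m hm)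
    · rw [hmR, RingHom.comp_apply, ← map_pow, ← map_sub]
    · rwa [RingHom.comp_apply, ← map_pow, ← map_sub]
    · intro a b hab
      refine mem_and_mem_of_add_mul_mem hdom t₁ ht a b ?_
      rw [RingHom.comp_apply, RingHom.comp_apply, ← map_mul, ← map_add,
        ← IsLocalRing.map_maximalIdeal_of_surjective mk Ideal.Quotient.mk_surjective, mk_mem_map_maximalIdeal_iff hIm] at hab
      exact hab
  have read : ∀ {N : ℕ} {G : Polynomial S₀}, G.degree < (2 * N : ℕ) → ∀ {a : S₁}, a ∈ maximalIdeal S₁ ^ N →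
      G.eval₂ ι t₁ - a ∈ I → ∀ j, G.coeff j ∈ maximalIdeal S₀ :=
    fun hdeg _ ha hcong => coeff_mem_of_reading h t₁ PL hdeg ha hcong
  -- ### the form `F` and the weak transform
  obtain ⟨F, hFhom, hFf⟩ := exists_form_eval_eq hXYZ hf
  have hF₁w : F₁ = eval₂ ι ![1, t₁, z₁] F := eq_eval₂_chart h hX0 t₁ z₁ htX hzX hFhom (by rw [hFf]; exact hF₁)
  obtain ⟨g₁, hg₁⟩ := hord
  set hh : S₁ := F₁ - g₁ ^ 2 with hhdef
  have hF₁eq : F₁ = g₁ ^ 2 + hh := by rw [hhdef]; ring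
  have hDF : ∀ D : Derivation ℤ S₁ S₁, D F₁ = D hh := fun D => by rw [hF₁eq, derivation_sq_add]
  -- ### the frame: tables of values
  have hd00 : dx 0 X = 1 := by simpa using hdx 0 0
  have hd01 : dx 0 Y = 0 := by simpa using hdx 0 1
  have hd02 : dx 0 Z = 0 := by simpa using hdx 0 2
  have hd10 : dx 1 X = 0 := by simpa using hdx 1 0
  have hd11 : dx 1 Y = 1 := by simpa using hdx 1 1
  have hd12 : dx 1 Z = 0 := by simpa using hdx 1 2
  have hd20 : dx 2 X = 0 := by simpa using hdx 2 0
  have hd21 : dx 2 Y = 0 := by simpa using hdx 2 1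
  have hd22 : dx 2 Z = 1 := by simpa using hdx 2 2
  have hduX : ∀ j, du j X = 0 := fun j => by simpa using hdux j 0
  have hduY : ∀ j, du j Y = 0 := fun j => by simpa using hdux j 1
  have hduZ : ∀ j, du j Z = 0 := fun j => by simpa using hdux j 2
  -- logarithmic derivations of `S₀`
  have hlogY : ∀ y ∈ maximalIdeal S₀, (X • dx 1) y ∈ maximalIdeal S₀ := fun y _ => by
    rw [Derivation.smul_apply, smul_eq_mul]; exact Ideal.mul_mem_right _ _ hXm
  have hlogZ : ∀ y ∈ maximalIdeal S₀, (X • dx 2) y ∈ maximalIdeal S₀ := fun y _ => by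
    rw [Derivation.smul_apply, smul_eq_mul]; exact Ideal.mul_mem_right _ _ hXm
  have hlogu : ∀ j, ∀ y ∈ maximalIdeal S₀, du j y ∈ maximalIdeal S₀ := fun j =>
    MemberDerivations.map_maximalIdeal_of_generators ![X, Y, Z] hx0 (du j) (fun i => by rw [hdux]; exact zero_mem _)
  set E : Derivation ℤ S₀ S₀ := X • dx 0 + Y • dx 1 + Z • dx 2 with hEdef
  have hEapp : ∀ y, E y = X * dx 0 y + Y * dx 1 y + Z * dx 2 y := fun y => by
    simp only [hEdef, Derivation.add_apply, Derivation.smul_apply, smul_eq_mul]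
  have hEX : E X = X := by rw [hEapp, hd00, hd10, hd20]; ring
  have hEY : E Y = Y := by rw [hEapp, hd01, hd11, hd21]; ring
  have hEZ : E Z = Z := by rw [hEapp, hd02, hd12, hd22]; ring
  have hEm : ∀ y, E y ∈ maximalIdeal S₀ := fun y => by
    rw [hEapp]
    exact Ideal.add_mem _ (Ideal.add_mem _ (Ideal.mul_mem_right _ _ hXm) (Ideal.mul_mem_right _ _ hYm))
      (Ideal.mul_mem_right _ _ hZm)
  -- ### extensions to `S₁` (F3) and their values on `t, z'`
  obtain ⟨Dt, hDt⟩ := exists_derivation_extend hQT h (X • dx 1) hlogY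
  obtain ⟨Dz, hDz⟩ := exists_derivation_extend hQT h (X • dx 2) hlogZ
  have hDuex : ∀ j, ∃ Dj : Derivation ℤ S₁ S₁, ∀ a, Dj (ι a) = ι (du j a) := fun j =>
    exists_derivation_extend hQT h (du j) (hlogu j)
  choose Du hDu using hDuex
  obtain ⟨E₁, hE₁⟩ := exists_derivation_extend hQT h E (fun y _ => hEm y)
  have eY_X : (X • dx 1) X = 0 := by rw [Derivation.smul_apply, smul_eq_mul, hd10, mul_zero]
  have eY_Y : (X • dx 1) Y = X := by rw [Derivation.smul_apply, smul_eq_mul, hd11, mul_one]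
  have eY_Z : (X • dx 1) Z = 0 := by rw [Derivation.smul_apply, smul_eq_mul, hd12, mul_zero]
  have eZ_X : (X • dx 2) X = 0 := by rw [Derivation.smul_apply, smul_eq_mul, hd20, mul_zero]
  have eZ_Y : (X • dx 2) Y = 0 := by rw [Derivation.smul_apply, smul_eq_mul, hd21, mul_zero]
  have eZ_Z : (X • dx 2) Z = X := by rw [Derivation.smul_apply, smul_eq_mul, hd22, mul_one]
  have hDtt : Dt t₁ = 1 := by
    have := apply_chart_mul h _ Dt hDt htX
    rw [eY_Y, eY_X, map_zero, mul_zero, sub_zero] at this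
    exact eq_of_mul_eq_mul_exc h hX0 (by rw [this, one_mul])
  have hDtz : Dt z₁ = 0 := by
    have := apply_chart_mul h _ Dt hDt hzX
    rw [eY_Z, eY_X, map_zero, mul_zero, sub_zero] at this
    exact eq_of_mul_eq_mul_exc h hX0 (by rw [this, zero_mul])
  have hDzt : Dz t₁ = 0 := by
    have := apply_chart_mul h _ Dz hDz htX
    rw [eZ_Y, eZ_X, map_zero, mul_zero, sub_zero] at this
    exact eq_of_mul_eq_mul_exc h hX0 (by rw [this, zero_mul])
  have hDzz : Dz z₁ = 1 := by
    have := apply_chart_mul h _ Dz hDz hzX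
    rw [eZ_Z, eZ_X, map_zero, mul_zero, sub_zero] at this
    exact eq_of_mul_eq_mul_exc h hX0 (by rw [this, one_mul])
  have hDut : ∀ j, Du j t₁ = 0 := fun j => by
    have := apply_chart_mul h _ (Du j) (hDu j) htX
    rw [hduY, hduX, map_zero, mul_zero, sub_zero] at this
    exact eq_of_mul_eq_mul_exc h hX0 (by rw [this, zero_mul])
  have hDuz : ∀ j, Du j z₁ = 0 := fun j => by
    have := apply_chart_mul h _ (Du j) (hDu j) hzX
    rw [hduZ, hduX, map_zero, mul_zero, sub_zero] at this
    exact eq_of_mul_eq_mul_exc h hX0 (by rw [this, zero_mul])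
  have hE₁t : E₁ t₁ = 0 := by
    have := apply_chart_mul h _ E₁ hE₁ htX
    rw [hEY, hEX, ← htX, sub_self] at this
    exact eq_of_mul_eq_mul_exc h hX0 (by rw [this, zero_mul])
  have hE₁z : E₁ z₁ = 0 := by
    have := apply_chart_mul h _ E₁ hE₁ hzX
    rw [hEZ, hEX, ← hzX, sub_self] at this
    exact eq_of_mul_eq_mul_exc h hX0 (by rw [this, zero_mul])
  have hE₁X : E₁ (ι X) = ι X := by rw [hE₁, hEX]
  have hE₁S : ∀ w : S₁, E₁ w ∈ Ideal.span {ι X} :=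
    apply_mem_span_exc_of_euler h hXYZ hX0 hB hfrac t₁ z₁ ht₁ hz₁ E₁
      (fun a => by rw [hE₁]; exact inclusion_mem_span_exc h hB hX0 (hEm a)) hE₁t hE₁z
  -- logarithmic on `𝔪₁`: `Dt` and `E₁`
  have hlogDt : ∀ y ∈ maximalIdeal S₁, Dt y ∈ maximalIdeal S₁ := by
    refine MemberDerivations.map_maximalIdeal_of_generators ![ι X, z₁, q] hx1 Dt fun i => ?_
    fin_cases i
    · show Dt (ι X) ∈ maximalIdeal S₁
      rw [hDt, eY_X, map_zero]; exact zero_mem _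
    · show Dt z₁ ∈ maximalIdeal S₁
      rw [hDtz]; exact zero_mem _
    · show Dt q ∈ maximalIdeal S₁
      rw [hqdef, map_sub, derivation_sq, zero_sub, hDt, Derivation.smul_apply, smul_eq_mul]
      exact Submodule.neg_mem _ (hm01 _ (Ideal.mul_mem_right _ _ hXm))
  have hlogE₁ : ∀ y ∈ maximalIdeal S₁, E₁ y ∈ maximalIdeal S₁ := fun y _ => hIm (hspanX_le (hE₁S y))
  -- coefficientwise derivatives with coefficients in `𝔪₀` evaluate into `I`
  have hevFD : ∀ (δ₀ : Derivation ℤ S₀ S₀), (∀ y, δ₀ y ∈ maximalIdeal S₀) →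
      eval₂ ι ![1, t₁, z₁] (∑ m ∈ F.support, monomial m (δ₀ (coeff m F))) ∈ I := fun δ₀ hδ₀ =>
    hmapm0 (mvPolynomial_eval₂_mem_map_of_forall_coeff_mem ι _ fun m => by
      rw [MemberDerivations.coeff_sum_monomial_derivation]; exact hδ₀ _)
  have hsmulm : ∀ (i : Fin 3) (y : S₀), (X • dx i) y ∈ maximalIdeal S₀ := fun i y => by
    rw [Derivation.smul_apply, smul_eq_mul]; exact Ideal.mul_mem_right _ _ hXm
  -- ### (R-z'): the `Z`-linear layer of `F` lies in `𝔪₀`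
  have hRz : ∀ j, (eval₂ Polynomial.C ![1, Polynomial.X, 0] (pderiv 2 F)).coeff j ∈ maximalIdeal S₀ := by
    refine read (N := n) (degree_theta_lt (isHomogeneous_pderiv_of hFhom 2) (by omega))
      (a := Dz hh) (apply_mem_pow_of_mem_pow_succ Dz _ n hg₁) ?_
    rw [eval₂_theta, ← hDF, hF₁w, derivation_eval₂_chart h _ Dz hDz, hDzt, hDzz, mul_zero, zero_add, mul_one]
    have h1 := eval₂_sub_eval₂_mem_span h t₁ z₁ (pderiv 2 F)
    have h2 := hevFD (X • dx 2) (hsmulm 2)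
    have : eval₂ ι ![1, t₁, 0] (pderiv 2 F) - (eval₂ ι ![1, t₁, z₁] (pderiv 2 F) +
        eval₂ ι ![1, t₁, z₁] (∑ m ∈ F.support, monomial m ((X • dx 2) (coeff m F)))) =
        -(eval₂ ι ![1, t₁, z₁] (pderiv 2 F) - eval₂ ι ![1, t₁, 0] (pderiv 2 F)) -
          eval₂ ι ![1, t₁, z₁] (∑ m ∈ F.support, monomial m ((X • dx 2) (coeff m F))) := by ring
    rw [this]
    exact Ideal.sub_mem _ (Submodule.neg_mem _ (hspanz_le h1)) h2
  have hlayer : ∀ m : Fin 3 →₀ ℕ, m 2 = 1 → F.coeff m ∈ maximalIdeal S₀ := by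
    intro m h2
    by_cases hc : F.coeff m = 0
    · rw [hc]; exact zero_mem _
    have hm := eq_layer_add_single_two h2 (degree_eq_of_coeff_ne_zero hFhom hc)
    rw [hm, ← coeff_theta_pderiv_two hFhom]
    exact hRz _
  have hρ : F₁ - (eval₂ Polynomial.C ![1, Polynomial.X, 0] F).eval₂ ι t₁ ∈ I ^ 2 := by
    rw [eval₂_theta, hF₁w]
    exact eval₂_sub_eval₂_mem_sq h hB hX0 t₁ z₁ hlayer
  -- ### (R-t): odd powers of `T` have coefficients in `𝔪₀`
  have hRt : ∀ j, (eval₂ Polynomial.C ![1, Polynomial.X, 0] (pderiv 1 F)).coeff j ∈ maximalIdeal S₀ := by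
    refine read (N := n + 1) (degree_theta_lt (isHomogeneous_pderiv_of hFhom 1) (by omega))
      (a := Dt hh) (apply_mem_pow_of_log Dt _ hlogDt (n + 1) hg₁) ?_
    rw [eval₂_theta, ← hDF, hF₁w, derivation_eval₂_chart h _ Dt hDt, hDtt, hDtz, mul_zero, add_zero, mul_one]
    have h1 := eval₂_sub_eval₂_mem_span h t₁ z₁ (pderiv 1 F)
    have h2 := hevFD (X • dx 1) (hsmulm 1)
    have : eval₂ ι ![1, t₁, 0] (pderiv 1 F) - (eval₂ ι ![1, t₁, z₁] (pderiv 1 F) +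
        eval₂ ι ![1, t₁, z₁] (∑ m ∈ F.support, monomial m ((X • dx 1) (coeff m F)))) =
        -(eval₂ ι ![1, t₁, z₁] (pderiv 1 F) - eval₂ ι ![1, t₁, 0] (pderiv 1 F)) -
          eval₂ ι ![1, t₁, z₁] (∑ m ∈ F.support, monomial m ((X • dx 1) (coeff m F))) := by ring
    rw [this]
    exact Ideal.sub_mem _ (Submodule.neg_mem _ (hspanz_le h1)) h2
  have hodd : ∀ i, ¬ Even i → F.coeff (Finsupp.single (0 : Fin 3) (n + 1 - i) + Finsupp.single 1 i) ∈ maximalIdeal S₀ := by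
    intro i hi
    rcases i with _ | j
    · exact absurd (show Even 0 from ⟨0, rfl⟩) hi
    have hj : Even j := by
      rcases Nat.even_or_odd j with hj | hj
      · exact hj
      · exact absurd (hj.add_odd odd_one) hi
    have hcast : ((j : S₀) + 1) = 1 := by
      rw [(CharP.cast_eq_zero_iff S₀ 2 j).mpr (even_iff_two_dvd.mp hj), zero_add]
    have := hRt j
    rw [coeff_theta_pderiv_one hFhom, layer_add_single_one, hcast, mul_one] at this
    exact this
  -- ### (R-u): every coefficient of `F(1, T, 0)` is a square mod `𝔪₀`
  have hRu : ∀ j i, du j (F.coeff (Finsupp.single (0 : Fin 3) (n + 1 - i) + Finsupp.single 1 i)) ∈ maximalIdeal S₀ := by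
    intro j i
    have := read (N := n) (degree_theta_lt (isHomogeneous_derivCoeff (du j) hFhom) (by omega))
      (a := Du j hh) (apply_mem_pow_of_mem_pow_succ (Du j) _ n hg₁) ?_ i
    · rwa [coeff_theta_derivCoeff (du j) hFhom] at this
    rw [eval₂_theta, ← hDF, hF₁w, derivation_eval₂_chart h _ (Du j) (hDu j), hDut, hDuz, mul_zero, mul_zero, zero_add, zero_add]
    exact hspanz_le (by
      have := eval₂_sub_eval₂_mem_span h t₁ z₁ (∑ m ∈ F.support, monomial m ((du j) (coeff m F)))
      rw [← neg_sub]
      exact Submodule.neg_mem _ this)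
  have hsq : ∀ i, ∃ s : S₀, F.coeff (Finsupp.single (0 : Fin 3) (n + 1 - i) + Finsupp.single 1 i) - s ^ 2 ∈ maximalIdeal S₀ :=
    fun i => MemberDerivations.residue_kernelExact_of_dual_frame 2 u δ du hgen hδu hδker hlogu hduu _ (fun j => hRu j i)
  choose s hs using hsq
  -- ### the square root `ψ₀` and the `X`-linear remainder `α`
  set c : ℕ → S₀ := fun i => F.coeff (Finsupp.single (0 : Fin 3) (n + 1 - i) + Finsupp.single 1 i) with hcdef
  set s' : ℕ → S₀ := fun i => if Even i then s i else 0 with hs'def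
  have hs'odd : ∀ i, ¬ Even i → s' i = 0 := fun i hi => by simp [hs'def, hi]
  have hm : ∀ i, c i - s' i ^ 2 ∈ maximalIdeal S₀ := fun i => by
    by_cases hi : Even i
    · simp only [hs'def, hi, if_true]; exact hs i
    · simp only [hs'def, hi, if_false]
      rw [zero_pow two_ne_zero, sub_zero]
      exact hodd i hi
  have habc : ∀ i, ∃ a b c' : S₀, c i - s' i ^ 2 = a * X + b * Y + c' * Z := fun i =>
    exists_eq_of_mem_span_triple (hXYZ.symm ▸ hm i)
  choose a b c' habc using habc
  set ψ₀ : S₁ := ∑ i ∈ Finset.range (n + 2), ι (s' i) * t₁ ^ (i / 2) with hψ₀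
  set α : S₁ := ∑ i ∈ Finset.range (n + 2), (ι (a i) + ι (b i) * t₁ + ι (c' i) * z₁) * t₁ ^ i with hα
  set GE : Polynomial S₀ := ∑ i ∈ Finset.range (n + 2), (Polynomial.C (a i) + Polynomial.C (b i) * Polynomial.X) * Polynomial.X ^ i
    with hGE
  -- `F(1, t, 0) = Σ ι(c i) t^i`
  have hP₀ : (eval₂ Polynomial.C ![1, Polynomial.X, 0] F).eval₂ ι t₁ = ∑ i ∈ Finset.range (n + 2), ι (c i) * t₁ ^ i := by
    have hnat : (eval₂ Polynomial.C ![1, Polynomial.X, 0] F).natDegree < n + 2 :=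
      Nat.lt_succ_of_le (Polynomial.natDegree_le_iff_degree_le.mpr (degree_theta_le hFhom))
    rw [Polynomial.eval₂_eq_sum_range' ι hnat]
    refine Finset.sum_congr rfl fun i _ => ?_
    rw [coeff_theta hFhom]
  -- `Σ ι(c i − s' i²) tⁱ = X · α`
  have hXα : ∑ i ∈ Finset.range (n + 2), ι (c i - s' i ^ 2) * t₁ ^ i = ι X * α := by
    rw [hα, Finset.mul_sum]
    refine Finset.sum_congr rfl fun i _ => ?_
    rw [habc i, map_add, map_add, map_mul, map_mul, map_mul, ← htX, ← hzX]
    ring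
  -- `F₁ = ψ₀² + X α + ρ`
  have hdecomp : F₁ - ψ₀ ^ 2 = ι X * α + (F₁ - (eval₂ Polynomial.C ![1, Polynomial.X, 0] F).eval₂ ι t₁) := by
    rw [hP₀, hψ₀, ← hXα, ← sum_sub_sq_sum_eq ι t₁ (n + 2) c s' hs'odd]
    ring
  -- `α ≡ G_E(t) mod I`
  have hαG : α - GE.eval₂ ι t₁ ∈ I := by
    rw [hGE, eval₂_sum_linear_mul_pow, hα, ← Finset.sum_sub_distrib]
    refine Submodule.sum_mem _ fun i _ => ?_
    have : (ι (a i) + ι (b i) * t₁ + ι (c' i) * z₁) * t₁ ^ i - (ι (a i) + ι (b i) * t₁) * t₁ ^ i =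
        (ι (c' i) * t₁ ^ i) * z₁ := by ring
    rw [this]
    exact Ideal.mul_mem_left _ _ hzI
  -- ### (R-E): `α ∈ I`
  set ρ : S₁ := F₁ - (eval₂ Polynomial.C ![1, Polynomial.X, 0] F).eval₂ ι t₁ with hρdef
  have hEρ : E₁ ρ ∈ Ideal.span {ι X} * I := apply_sq_mem_of_forall_mem_span E₁ hE₁S I hρ
  obtain ⟨ρ', hρ'I, hρ'⟩ := Ideal.mem_span_singleton_mul.mp hEρ
  obtain ⟨α', hα'⟩ := Ideal.mem_span_singleton'.mp (hE₁S α)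
  have hEF₁ : E₁ F₁ = ι X * (α + α' * ι X + ρ') := by
    have h1 : F₁ = ψ₀ ^ 2 + (ι X * α + ρ) := by rw [← hdecomp]; ring
    rw [h1, derivation_sq_add, map_add, E₁.leibniz, smul_eq_mul, smul_eq_mul, hE₁X, ← hρ', ← hα']
    ring
  have hEF₁m : E₁ F₁ ∈ maximalIdeal S₁ ^ (n + 1) := by
    rw [hDF]
    exact apply_mem_pow_of_log E₁ _ hlogE₁ (n + 1) hg₁
  have ha₀ : α + α' * ι X + ρ' ∈ maximalIdeal S₁ ^ n := by
    refine mem_pow_of_exc_mul_mem hX2 ?_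
    rw [← hEF₁]
    exact hEF₁m
  have hGEcoeff : ∀ j, GE.coeff j ∈ maximalIdeal S₀ := by
    refine read (N := n) (degree_sum_linear_mul_pow_lt (n + 2) a b (by omega)) (a := α + α' * ι X + ρ') ha₀ ?_
    have : GE.eval₂ ι t₁ - (α + α' * ι X + ρ') = -(α - GE.eval₂ ι t₁) - α' * ι X - ρ' := by ring
    rw [this]
    exact Ideal.sub_mem _ (Ideal.sub_mem _ (Submodule.neg_mem _ hαG) (Ideal.mul_mem_left _ _ hXI)) hρ'I
  have hGEI : GE.eval₂ ι t₁ ∈ I := hmapm0 (eval₂_mem_map_of_forall_coeff_mem ι t₁ hGEcoeff)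
  have hαI : α ∈ I := by
    have : α = (α - GE.eval₂ ι t₁) + GE.eval₂ ι t₁ := by ring
    rw [this]
    exact Ideal.add_mem _ hαG hGEI
  -- ### conclusion
  refine ⟨ψ₀, ?_⟩
  rw [hdecomp, pow_two]
  exact Ideal.add_mem _ (Ideal.mul_mem_mul hXI hαI) (by rw [← pow_two]; exact hρ)

end Summit.ResolutionOfSingularities.ResolutionOfSingularities.Theorems.SwitchingDichotomy.LemmaI

end
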